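/-
Copyright (c) 2026 the pub-hodgecm-mathlib formalisation cell (harness21).  Prover seat hodgecm-mathlib-LH5-p05 (g6); dealer LH4-plan (g7) WORD #46 (the `…Closed`
sequel of (C5)′ JPos, LH3-p01 (g7)), 2026-09-02.  Body = ★ `UnitOrbitalIntegralInertCountJPosClosed` (A-p03 (g24)) verbatim over the 2-free (C2)′ package.
-/
import Literature.NumberTheory.Rogawski1990.UnitOrbitalIntegralInertCountJPosTrace        -- ★ p852112 (C5)′ JPos (LH3-p01 (g7)): `natCard_cosets_eq_iTen_of_rel` (trace corner; Prop. 8's numbers as hypotheses)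
import Literature.NumberTheory.Rogawski1990.UnitOrbitalIntegralInertCountJPosTorusTrace   -- (C5)′ JPos second half (LH3-p01 (g7)): `natCard_cosets_traceTorus_eq_iTen_of_rel` (trace literal)
import Literature.NumberTheory.Automorphic.UnitaryThreePHTowerPackageTrace           -- ★ p852072 C2-C: `index_flickerHK_subgroupOf_flickerPH_eq{,_one}_of_rel`, `finite_quotient_flickerHK_of_rel`, `natCard_fibre_flickerPHRho_eq_of_rel`
import Literature.NumberTheory.Automorphic.UnitaryThreePHTowerIndexTrace             -- ★ p852004 C2-B: `inf_flickerHK_le_flickerPH0_of_rel`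
import HarnessLib

/-!
# Flicker's PROPOSITION 10, closed form, WITHOUT `|2| = 1`: the `P_H`-coset count of a trace corner ∕ of the trace torus literal equals `iTen` — Prop. 8's numbers
# discharged by the 2-free package (C2)′ (Flicker 1998, Prop. 10 pp. 85–86, Prop. 8 p. 84 — every residue characteristic)

Topic `NumberTheory/Rogawski1990` (half A line LH4, LAYER C of the (D-UNR) type-(1) column, (C5)′ row «CountJPos» + «Closed» of CENSUS-C5 bd72510a (LH3-p02 (g6));
dealer LH4-plan (g7) WORD #46); namespace `Literature.NumberTheory.Automorphic.UnitaryGroup` (= ★'s).  THEOREMS ONLY: no definition, no named fact, no instance,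
no notation, no `sorry`; kernel lane `--supports stmt-HodgeConjecture-24833`; NOT an edition of ★ `UnitOrbitalIntegralInertCountJPosClosed` (untouched).

(C5)′ ★ p852112 `UnitOrbitalIntegralInertCountJPosTrace` ∕ `UnitOrbitalIntegralInertCountJPosTorusTrace` (LH3-p01 (g7)) prove Prop. 10 for a trace corner `τ = !![A,0,B₂p; 0,b,0; B₂,0,D]`
and for the trace torus literal `M_{b,π₁,π₁′}(x₁,x₂,x₃)` of ★ F1 modulo the five Prop-8 inputs `hidx0 hidx hSN [Finite] hfib`, exactly as ★ `natCard_cosets_eq_iTen` did in Flicker's frame; the 2-free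
package proves all five in the same binder text for the level element `u_m^{(y,z)}`: ★ p852072 C2-C `index_flickerHK_subgroupOf_flickerPH_eq_one_of_rel` (`m = 0`),
`index_flickerHK_subgroupOf_flickerPH_eq_of_rel` (`[P_H : P_H ∩ H^K_m] = (q²−1)q^{4m−2}`), `finite_quotient_flickerHK_of_rel`, `natCard_fibre_flickerPHRho_eq_of_rel` (fibres of
`ρ_m` have `q^m` elements) and ★ p852004 C2-B `inf_flickerHK_le_flickerPH0_of_rel` (`P_H ∩ H^K_m ≤ N₀`).  This file plugs them in — **`natCard_cosets_eq_iTen_of_rel_of_package`**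
(trace corner) and **`natCard_cosets_traceTorus_eq_iTen_of_rel_of_package`** (trace literal, `1 ≤ j ≤ N`): FLICKER'S PROP. 10 in the trace frame with only the σ-defect
bound `hσd` resp. nothing beyond the literal's data, and the unramifiedness∕residue-field data `hσO`, `ha₀`, `hq`, left as inputs (all discharged at `K = L_w` by ★
`unramifiedLocalConjDatum_adicCompletion` + ★ `exists_isUnit_map_sub_of_residueHom_ne`).  Twin of ★ `natCard_cosets_eq_iTen_of_package`; values `iTen q ν N₊ m` ∕
`iTen q (N − j) N₊ m` VERBATIM (these JPos cells carry no FINDING-#19 correction at any residue characteristic — LH3-p01 (g7) (c1) 16:15:51Z ∕ 17:02Z, type A and B).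
HONEST LABEL: HC_CM is proved only modulo the 7 printed citations (2 remaining: hLiu418 = stmt-HodgeConjecture-24832, h413 = stmt-HodgeConjecture-24833) until rung 0
closes; this file is a 30-line junction, count-neutral ((D-UNR) PRINT by D74′).

## References
* [Flicker1998UnitaryFL] Y. Z. Flicker, *Elementary proof of the fundamental lemma for a unitary group*, Canad. J. Math. 50 (1998), 74–98: Prop. 10 pp. 85–86, Prop. 8 p. 84, Cor. 9 p. 85.
* [Rogawski1990] J. D. Rogawski, *Automorphic Representations of Unitary Groups in Three Variables* (1990), §4.9 p. 55.
-/

set_option autoImplicit false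

open scoped MatrixGroups WithZero Valued
open Matrix

namespace Literature.NumberTheory.Automorphic

namespace UnitaryGroup

open Literature.NumberTheory.Automorphic.HermitianLattice (unitaryInt mem_unitaryInt_iff UnramifiedLocalConjDatum)
open Literature.NumberTheory.Rogawski1990.Flicker1998 (iTen)
open IsLocalRing

variable {K : Type*} [Field K] [Valued K ℤᵐ⁰] {ϖ : K} (σ : K →+* K) {J : Matrix (Fin 3) (Fin 3) K}
variable [IsDiscreteValuationRing 𝒪[K]] [Finite (ResidueField 𝒪[K])] [IsAdicComplete (maximalIdeal 𝒪[K]) 𝒪[K]]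

/-- **FLICKER'S PROPOSITION 10 FOR A TRACE CORNER, Prop. 8's numbers discharged** (2-free; twin of ★ `natCard_cosets_eq_iTen_of_package`): for
`τ = !![A,0,B₂p; 0,b,0; B₂,0,D] ∈ H` with `|B₂| = |ϖ^ν|`, `|p| < 1`, `σp = p`, `|A − b| = |ϖ^{N₊}|`, `|A − D| < |B₂|`, and the 2-free level element `u_m^{(y,z)}`:
`#{w ∈ P_H ⧸ (P_H ∩ H^K_m) : w̃⁻¹ τ w̃ ∈ H^K_m} = iTen q ν N₊ m` (as a rational number), for every `m` — (C5)′ `natCard_cosets_eq_iTen_of_rel` with `hidx0 ∕ hidx ∕ hSN ∕ [Finite] ∕ hfib`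
supplied by ★ C2-C p852072 and ★ C2-B p852004. [cite: Flicker1998UnitaryFL, Prop. 10 pp. 85–86; Prop. 8 p. 84] -/
theorem natCard_cosets_eq_iTen_of_rel_of_package (hJ : J = (StdForm.antidiagonal 3).over K) (hd : UnramifiedLocalConjDatum σ ϖ) (h2 : (2 : K) ≠ 0)
    (hσO : ∀ y : 𝒪[K], (σ.comp 𝒪[K].subtype) y ∈ 𝒪[K]) {y z : K} (hy : Valued.v y = 1) (hzv : Valued.v z ≤ 1) (hz : z + σ z + y * σ y = 0)
    {m ν Np : ℕ}
    {c um τ : ↥(unitaryGroupOfForm σ J)} (hc : ((c : GL (Fin 3) K) : Matrix (Fin 3) (Fin 3) K) = !![1, 0, 0; 0, -1, 0; 0, 0, 1])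
    (hum : ((um : GL (Fin 3) K) : Matrix (Fin 3) (Fin 3) K) = !![ϖ ^ m, y, z * (ϖ ^ m)⁻¹; 0, 1, -σ y * (ϖ ^ m)⁻¹; 0, 0, (ϖ ^ m)⁻¹])
    {A B₁ B₂ D b p : K} (hB₁ : B₁ = B₂ * p) (hvp : Valued.v p < 1) (hσp : σ p = p)
    (hτ : ((τ : GL (Fin 3) K) : Matrix (Fin 3) (Fin 3) K) = !![A, 0, B₁; 0, b, 0; B₂, 0, D])
    (hτH : τ ∈ Subgroup.centralizer ({c} : Set ↥(unitaryGroupOfForm σ J)))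
    (hB₂ : Valued.v B₂ = Valued.v (ϖ ^ ν)) (hs : Valued.v (A - b) = Valued.v (ϖ ^ Np)) (hAD : Valued.v (A - D) < Valued.v B₂)
    (hσd : Np = ν → m ≤ ν → ν < 2 * m → Valued.v (σ ((A - b) / B₂) - (D - b) / B₂) ≤ Valued.v (ϖ ^ (2 * m - ν)))
    {q : ℕ} (hq : Nat.card (ResidueField 𝒪[K]) = q ^ 2)
    {a₀ : 𝒪[K]} (ha₀ : IsUnit (((σ.comp 𝒪[K].subtype).codRestrict 𝒪[K] hσO) a₀ - a₀)) :
    (Nat.card {w : ↥(flickerPH σ J c) ⧸ (flickerHK σ J c um).subgroupOf (flickerPH σ J c) //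
      ((Quotient.out w : ↥(flickerPH σ J c)) : ↥(unitaryGroupOfForm σ J))⁻¹ * τ * (Quotient.out w : ↥(flickerPH σ J c)) ∈ flickerHK σ J c um} : ℚ) =
      iTen q ν Np m := by
  haveI := finite_quotient_flickerHK_of_rel σ hJ hd h2 hy hzv hz hσO m hum hc hq ha₀
  refine natCard_cosets_eq_iTen_of_rel σ hJ hd h2 hσO hy hzv hz hc hum hB₁ hvp hσp hτ hτH hB₂ hs hAD hσd hq ha₀ ?_ ?_
    (inf_flickerHK_le_flickerPH0_of_rel σ hJ hd h2 hy hzv hz m hum hc)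
    (natCard_fibre_flickerPHRho_eq_of_rel σ hJ hd h2 hy hzv hz hσO m hum hc hq ha₀)
  · rintro rfl
    exact index_flickerHK_subgroupOf_flickerPH_eq_one_of_rel σ hJ hd h2 hy hzv hz hσO hum hc hq ha₀
  · intro hm
    exact index_flickerHK_subgroupOf_flickerPH_eq_of_rel σ hJ hd h2 hy hzv hz hσO hm hum hc hq ha₀

/-- **FLICKER'S PROPOSITION 10 AT THE TRACE LITERAL, Prop. 8's numbers discharged** (2-free; `1 ≤ j ≤ N`): for ★ F1's trace torus block
`t = M_{b,π₁,π₁′}(x₁,x₂,x₃) = !![x₁σb + x₃b, 0, π₁(x₁−x₃); 0, x₂, 0; π₁′bσb(x₁−x₃), 0, x₁b + x₃σb] ∈ H` (`b + σb = 1`, `|b| ≤ 1`, `π₁π₁′ = 1`, `σπ₁ = π₁`, `|π₁| = |ϖ^j|`,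
norm-one `x₁, x₂, x₃`, `|x₁ − x₃| = |ϖ^N|`, `|(x₁−x₂)σb + (x₃−x₂)b| = |ϖ^{N₊}|`) and the 2-free level element `u_m^{(y,z)}`:
`#{w ∈ P_H ⧸ (P_H ∩ H^K_m) : w̃⁻¹ t w̃ ∈ H^K_m} = iTen q (N − j) N₊ m` — (C5)′ `natCard_cosets_traceTorus_eq_iTen_of_rel` with `hidx0 ∕ hidx ∕ hSN ∕ [Finite] ∕ hfib` supplied by
★ C2-C p852072 and ★ C2-B p852004.  With ★ p852062 (`j > N ⇒ 0`) this is the whole `j ≥ 1` column of the trace-frame Cor. 9 sum. [cite: Flicker1998UnitaryFL, Prop. 10 pp. 85–86; Cor. 9 p. 85; Prop. 8 p. 84] -/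
theorem natCard_cosets_traceTorus_eq_iTen_of_rel_of_package (hJ : J = (StdForm.antidiagonal 3).over K) (hd : UnramifiedLocalConjDatum σ ϖ) (h2 : (2 : K) ≠ 0)
    (hσO : ∀ y : 𝒪[K], (σ.comp 𝒪[K].subtype) y ∈ 𝒪[K]) {y z : K} (hy : Valued.v y = 1) (hzv : Valued.v z ≤ 1) (hz : z + σ z + y * σ y = 0)
    {m : ℕ} {c um t : ↥(unitaryGroupOfForm σ J)} (hc : ((c : GL (Fin 3) K) : Matrix (Fin 3) (Fin 3) K) = !![1, 0, 0; 0, -1, 0; 0, 0, 1])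
    (hum : ((um : GL (Fin 3) K) : Matrix (Fin 3) (Fin 3) K) = !![ϖ ^ m, y, z * (ϖ ^ m)⁻¹; 0, 1, -σ y * (ϖ ^ m)⁻¹; 0, 0, (ϖ ^ m)⁻¹])
    {b π₁ π₁' x₁ x₂ x₃ : K} (hb : b + σ b = 1) (hbv : Valued.v b ≤ 1) (hππ : π₁ * π₁' = 1) (hσπ : σ π₁ = π₁)
    {j : ℕ} (hπj : Valued.v π₁ = Valued.v (ϖ ^ j))
    (hx₁ : σ x₁ * x₁ = 1) (hx₂ : σ x₂ * x₂ = 1) (hx₃ : σ x₃ * x₃ = 1)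
    (hte : ((t : GL (Fin 3) K) : Matrix (Fin 3) (Fin 3) K) =
      !![x₁ * σ b + x₃ * b, 0, π₁ * (x₁ - x₃); 0, x₂, 0; π₁' * (b * σ b * (x₁ - x₃)), 0, x₁ * b + x₃ * σ b])
    (htH : t ∈ Subgroup.centralizer ({c} : Set ↥(unitaryGroupOfForm σ J)))
    {N Np : ℕ} (hN : Valued.v (x₁ - x₃) = Valued.v (ϖ ^ N)) (hNp : Valued.v ((x₁ - x₂) * σ b + (x₃ - x₂) * b) = Valued.v (ϖ ^ Np))
    (hj : 1 ≤ j) (hjN : j ≤ N)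
    {q : ℕ} (hq : Nat.card (ResidueField 𝒪[K]) = q ^ 2)
    {a₀ : 𝒪[K]} (ha₀ : IsUnit (((σ.comp 𝒪[K].subtype).codRestrict 𝒪[K] hσO) a₀ - a₀)) :
    (Nat.card {w : ↥(flickerPH σ J c) ⧸ (flickerHK σ J c um).subgroupOf (flickerPH σ J c) //
      ((Quotient.out w : ↥(flickerPH σ J c)) : ↥(unitaryGroupOfForm σ J))⁻¹ * t * (Quotient.out w : ↥(flickerPH σ J c)) ∈ flickerHK σ J c um} : ℚ) =
      iTen q (N - j) Np m := by
  haveI := finite_quotient_flickerHK_of_rel σ hJ hd h2 hy hzv hz hσO m hum hc hq ha₀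
  refine natCard_cosets_traceTorus_eq_iTen_of_rel σ hJ hd h2 hσO hy hzv hz hc hum hb hbv hππ hσπ hπj hx₁ hx₂ hx₃ hte htH hN hNp hj hjN hq ha₀ ?_ ?_
    (inf_flickerHK_le_flickerPH0_of_rel σ hJ hd h2 hy hzv hz m hum hc)
    (natCard_fibre_flickerPHRho_eq_of_rel σ hJ hd h2 hy hzv hz hσO m hum hc hq ha₀)
  · rintro rfl
    exact index_flickerHK_subgroupOf_flickerPH_eq_one_of_rel σ hJ hd h2 hy hzv hz hσO hum hc hq ha₀
  · intro hm
    exact index_flickerHK_subgroupOf_flickerPH_eq_of_rel σ hJ hd h2 hy hzv hz hσO hm hum hc hq ha₀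

end UnitaryGroup

end Literature.NumberTheory.Automorphic
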